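import Mathlib
import Summits.Ventures.HodgeRepro.Tier4.Common.HoloTransfer

/-!
# Tier4/Common/HoloFinite — **(T2) DISCHARGED**: the holomorphic forms of `X_{Γ′}` over a relatively compact
fundamental domain form a FINITE-DIMENSIONAL space, given the proper discontinuity of the ball action

Blind re-derivation cell `pub-hodge-repro`, Tier 4 (README §9–§10), seat t4-typer-1 (gen 1).  Target tree path
`lean/Summits/Ventures/HodgeRepro/Tier4/Common/HoloFinite.lean`.  Imports `HoloTransfer` (typer-1 g1: injectivity of
the restriction to the fundamental domain, the bound transfer through finitely many `γ`), hence `HoloEstimates`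
(the Cauchy / Lipschitz estimates), `HoloForms` (`HForm`), `HeckeRegularity`.

THE STATEMENT.  `TargetData.finiteDimensional_holoForms`: for a level `Γ′ ≤ Γ`, a measurable fundamental domain `D`
with `closure D ⊆ 𝔹²`, and the proper discontinuity of the ball action of `Γ′` in the shape
«for every compact `K ⊆ 𝔹²`, only finitely many `γ ∈ Γ′` have `γ·K ∩ K ≠ ∅`» — EXACTLY the conclusion of the printed
input `Lit.BorelHarishChandra1962_properlyDiscontinuous_hdef` (t4-lit-3, Borel–Harish-Chandra 1962) — the ℂ-space
`d.HForm Γ' D` of holomorphic forms of `X_{Γ′}` is finite-dimensional.  This is the Cartan–Serre finiteness of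
`H^0(X_{Γ′}, Ω^1) ⊕ H^0(X_{Γ′}, Ω^2)` for the compact quotient, proved here from Mathlib alone:

THE PROOF.  Let `K = closure D` (compact, inside `{nsq ≤ r₁}` for some `r₁ < 1`) and `r₂ = (r₁+1)/2`.
1. Restriction to `K` is an injective ℂ-linear map `ι` from `HForm` to the bounded continuous functions `K →ᵇ ℂ² × ℂ`
   (`HoloTransfer.eq_zero_of_eqOn_domain`: a form vanishing on `D` vanishes).
2. A form with `‖ι x‖ ≤ 3` is bounded by `3J` on `{nsq < r₂}`, `J` the uniform Jacobian weight of the finitely many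
   `γ` moving `{nsq ≤ r₂}` into itself (`HoloTransfer.forall_norm_le_of_domain`), hence `L`-Lipschitz on `K` with
   `L = 2·3J/ρ`, `ρ = (r₂ − r₁)/4` (`HoloEstimates.norm_sub_le_of_bounded`, the Cauchy estimate on complex lines).
3. Arzelà–Ascoli (`BoundedContinuousFunction.arzela_ascoli`): the set `A` of such restrictions is equicontinuous with
   values in a compact ball, so `closure A` is compact and `A` is totally bounded; so is the closed ball of radius
   `3` of the normed space `range ι`.
4. Riesz (`exists_seq_norm_le_one_le_norm_sub'`): an infinite-dimensional normed space contains a `1`-separated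
   sequence in the ball of radius `3`, which a totally bounded set cannot hold (`finiteDimensional_of_totallyBounded`).
   So `range ι ≅ HForm` is finite-dimensional.

CONSEQUENCE (`P_T4_of_concrete_pd`, `P_T4_of_concrete_BHC`): the frozen `P_T4` follows from «(P) for the concrete
witness» of every datum given ONLY a level `Γ′`, a relatively compact measurable fundamental domain `D`, and the
printed proper discontinuity — the hypothesis `hfin` of `CornerHolo.P_T4_of_concrete''` is gone.

Nothing here says anything about the status of the Hodge conjecture for CM abelian varieties, which is NOT proved
(HC_CM is NOT proved by anyone in this repository).
-/

set_option autoImplicit false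

noncomputable section

open Matrix MeasureTheory NumberField Set
open scoped ComplexConjugate ComplexOrder

namespace Summit.Ventures.HodgeRepro.Tier4

open Summit.Ventures.HodgeRepro.Tier4.Common

/-! ## Riesz: a totally bounded ball forbids infinite dimension -/

/-- A normed space over `ℂ` whose ball `{‖v‖ ≤ 3}` is totally bounded is finite-dimensional
(an infinite-dimensional space contains a `1`-separated sequence in that ball). -/
theorem finiteDimensional_of_totallyBounded {V : Type} [NormedAddCommGroup V] [NormedSpace ℂ V]
    (h : TotallyBounded {v : V | ‖v‖ ≤ 3}) : FiniteDimensional ℂ V := by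
  by_contra hnot
  obtain ⟨f, hf3, hfsep⟩ := exists_seq_norm_le_one_le_norm_sub' (𝕜 := ℂ) (E := V) (c := (2 : ℂ))
    (by norm_num) (R := 3) (by norm_num) hnot
  obtain ⟨t, htfin, hcover⟩ := Metric.totallyBounded_iff.1 h (1 / 2) (by norm_num)
  have hch : ∀ n, ∃ y ∈ t, f n ∈ Metric.ball y (1 / 2) := fun n => by
    have hmem : f n ∈ {v : V | ‖v‖ ≤ 3} := hf3 n
    simpa using Set.mem_iUnion₂.1 (hcover hmem)
  choose y hy using hch
  haveI : Finite t := htfin.to_subtype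
  obtain ⟨m, n, hmn, heq⟩ := Finite.exists_ne_map_eq_of_infinite (fun n => (⟨y n, (hy n).1⟩ : t))
  have hym : y m = y n := congrArg Subtype.val heq
  have h1 : 1 ≤ ‖f m - f n‖ := hfsep hmn
  have hd : dist (f m) (f n) < 1 := by
    calc dist (f m) (f n) ≤ dist (f m) (y m) + dist (y m) (f n) := dist_triangle _ _ _
      _ < 1 / 2 + 1 / 2 := add_lt_add (Metric.mem_ball.1 (hy m).2)
          (by rw [hym, dist_comm]; exact Metric.mem_ball.1 (hy n).2)
      _ = 1 := by norm_num
  rw [dist_eq_norm] at hd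
  linarith

namespace TargetData

variable {F E : Type} [Field F] [NumberField F] [IsGalois ℚ F] [IsCMField F]
  [Field E] [NumberField E] [IsGalois ℚ E] [IsCMField E] (d : TargetData F E)

/-! ## The restriction map to a compact `K ⊆ 𝔹²` -/

section Restriction

variable {Γ' : Set (Matrix (Fin 3) (Fin 3) E)} {D : Set (Fin 2 → ℂ)} {K : Set (Fin 2 → ℂ)}

/-- The restriction of a holomorphic form of `X_{Γ′}` to `K ⊆ 𝔹²`, as a continuous map `K → ℂ² × ℂ`. -/
def restrictC (hKb : K ⊆ ball) (x : d.HForm Γ' D) : C(K, (Fin 2 → ℂ) × ℂ) :=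
  ⟨fun z => (x.1.1 z, x.1.2 z),
    ((x.2.2.1.continuousOn.mono hKb).prodMk (x.2.2.2.continuousOn.mono hKb)).restrict⟩

/-- Evaluation of the restriction. -/
@[simp] theorem restrictC_apply (hKb : K ⊆ ball) (x : d.HForm Γ' D) (z : K) :
    d.restrictC hKb x z = (x.1.1 z, x.1.2 z) := rfl

variable [CompactSpace K]

/-- **The restriction map** `HForm → (K →ᵇ ℂ² × ℂ)`, ℂ-linear. -/
def restrictL (hKb : K ⊆ ball) : d.HForm Γ' D →ₗ[ℂ] BoundedContinuousFunction K ((Fin 2 → ℂ) × ℂ) where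
  toFun x := BoundedContinuousFunction.mkOfCompact (d.restrictC hKb x)
  map_add' x y := by
    refine BoundedContinuousFunction.ext fun z => ?_
    simp only [BoundedContinuousFunction.mkOfCompact_apply, restrictC_apply, BoundedContinuousFunction.add_apply]
    rfl
  map_smul' c x := by
    refine BoundedContinuousFunction.ext fun z => ?_
    simp only [BoundedContinuousFunction.mkOfCompact_apply, restrictC_apply, BoundedContinuousFunction.smul_apply,
      RingHom.id_apply]
    rfl

/-- Evaluation of the restriction map. -/
theorem restrictL_apply (hKb : K ⊆ ball) (x : d.HForm Γ' D) (z : K) :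
    d.restrictL hKb x z = (x.1.1 z, x.1.2 z) := by
  simp [restrictL]

/-- The restriction map to a compact set containing a fundamental domain is injective. -/
theorem restrictL_injective (hKb : K ⊆ ball) (hDom : d.IsDomain Γ' D) (hDK : D ⊆ K) :
    Function.Injective (d.restrictL (Γ' := Γ') (D := D) hKb) := by
  rw [injective_iff_map_eq_zero]
  intro x hx
  have hz : ∀ z ∈ D, x.1.1 z = 0 ∧ x.1.2 z = 0 := by
    intro z hzD
    have := congrArg (fun f : BoundedContinuousFunction K ((Fin 2 → ℂ) × ℂ) => f ⟨z, hDK hzD⟩) hx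
    simp only [restrictL_apply, BoundedContinuousFunction.coe_zero, Pi.zero_apply] at this
    exact Prod.mk_eq_zero.1 this
  exact Subtype.ext
    (d.eq_zero_of_eqOn_domain hDom x.2 (fun z hz' => (hz z hz').1) (fun z hz' => (hz z hz').2))

end Restriction

/-! ## The uniform Lipschitz bound on restrictions -/

/-- A holomorphic form of `X_{Γ′}` bounded by `M` on `{nsq < r₂}` is Lipschitz on `{nsq ≤ r₁}` (`r₁ < r₂ ≤ 1`) with
constant `2M/ρ`, `ρ = (r₂ − r₁)/4`, as a map to `ℂ² × ℂ`. -/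
theorem dist_restrict_le {Γ' : Set (Matrix (Fin 3) (Fin 3) E)} {D : Set (Fin 2 → ℂ)} {r₁ r₂ : ℝ} (h12 : r₁ < r₂)
    (h2 : r₂ ≤ 1) {x : d.HForm Γ' D} {M : ℝ} (hbd : ∀ w ∈ oball r₂, ‖x.1.1 w‖ ≤ M ∧ ‖x.1.2 w‖ ≤ M)
    {z w : Fin 2 → ℂ} (hz : z ∈ cball r₁) (hw : w ∈ cball r₁) :
    ‖(x.1.1 z, x.1.2 z) - (x.1.1 w, x.1.2 w)‖ ≤ 2 * (M / ((r₂ - r₁) / 4)) * ‖z - w‖ := by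
  have hM0 : 0 ≤ M := le_trans (norm_nonneg _) (hbd z (cball_subset_oball h12 hz)).1
  have hC : 0 ≤ 2 * (M / ((r₂ - r₁) / 4)) * ‖z - w‖ :=
    mul_nonneg (mul_nonneg (by norm_num) (div_nonneg hM0 (by linarith))) (norm_nonneg _)
  rw [Prod.norm_def, Prod.fst_sub, Prod.snd_sub]
  refine max_le ?_ ?_
  · rw [pi_norm_le_iff_of_nonneg hC]
    intro k
    rw [Pi.sub_apply]
    have hu : DifferentiableOn ℂ (fun v => x.1.1 v k) (oball r₂) :=
      (differentiableOn_pi.1 (x.2.2.1.mono (oball_subset_ball h2))) k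
    have hM : ∀ v ∈ oball r₂, ‖x.1.1 v k‖ ≤ M := fun v hv => (norm_le_pi_norm _ k).trans (hbd v hv).1
    exact norm_sub_le_of_bounded h12 h2 hu hM hz hw
  · have hu : DifferentiableOn ℂ x.1.2 (oball r₂) := x.2.2.2.mono (oball_subset_ball h2)
    exact norm_sub_le_of_bounded h12 h2 hu (fun v hv => (hbd v hv).2) hz hw

/-! ## (T2) -/

/-- **(T2) — the holomorphic forms of `X_{Γ′}` are finite-dimensional** (Cartan–Serre), for a level `Γ′`, a measurable
fundamental domain `D` with `closure D ⊆ 𝔹²`, and the proper discontinuity of the ball action of `Γ′` (for every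
compact `K ⊆ 𝔹²`, only finitely many `γ ∈ Γ′` move `K` into itself — the conclusion of the printed
`Lit.BorelHarishChandra1962_properlyDiscontinuous_hdef`). -/
theorem finiteDimensional_holoForms {Γ' : Set (Matrix (Fin 3) (Fin 3) E)} (hΓ' : d.IsLevel Γ')
    {D : Set (Fin 2 → ℂ)} (hDom : d.IsDomain Γ' D) (hDc : closure D ⊆ ball)
    (hpd : ∀ K : Set (Fin 2 → ℂ), IsCompact K → K ⊆ ball → {γ ∈ Γ' | ∃ z ∈ K, d.act γ z ∈ K}.Finite) :
    FiniteDimensional ℂ (d.HForm Γ' D) := by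
  have hK : IsCompact (closure D) := isCompact_closure_of_subset_ball hDc
  haveI : CompactSpace (closure D) := isCompact_iff_compactSpace.1 hK
  have hDK : D ⊆ closure D := subset_closure
  obtain ⟨r₁, hr₁, hKr⟩ := exists_cball_of_isCompact hK hDc
  have h12 : r₁ < (r₁ + 1) / 2 := by linarith
  have hr₂ : (r₁ + 1) / 2 < 1 := by linarith
  have hDK₂ : D ⊆ cball ((r₁ + 1) / 2) := fun z hz =>
    mem_cball.2 ((mem_cball.1 (hKr (hDK hz))).trans h12.le)
  obtain ⟨J, hJ0, hJ⟩ := d.forall_norm_le_of_domain hΓ' hDom hr₂ hDK₂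
    (hpd _ (isCompact_cball _) (cball_subset_ball hr₂))
  -- the restriction map to `K = closure D`
  set ι := d.restrictL (Γ' := Γ') (D := D) (K := closure D) hDc with hι
  have hinj : Function.Injective ι := d.restrictL_injective hDc hDom hDK
  -- the restrictions of the forms of norm `≤ 3`
  set A : Set (BoundedContinuousFunction (closure D) ((Fin 2 → ℂ) × ℂ)) := {f | ∃ x, ι x = f ∧ ‖f‖ ≤ 3} with hA
  have hbound : ∀ x : d.HForm Γ' D, ‖ι x‖ ≤ 3 →
      ∀ w ∈ oball ((r₁ + 1) / 2), ‖x.1.1 w‖ ≤ J * 3 ∧ ‖x.1.2 w‖ ≤ J * 3 := by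
    intro x hx
    refine hJ x.1 x.2 3 fun z hz => ?_
    have h := (BoundedContinuousFunction.norm_coe_le_norm (ι x) ⟨z, hDK hz⟩).trans hx
    rw [hι, restrictL_apply] at h
    exact ⟨(norm_fst_le _).trans h, (norm_snd_le _).trans h⟩
  -- equicontinuity of `A`
  set L : ℝ := 2 * (J * 3 / (((r₁ + 1) / 2 - r₁) / 4)) with hL
  have hequi : Equicontinuous
      (fun f : A => ((f : BoundedContinuousFunction (closure D) ((Fin 2 → ℂ) × ℂ)) : closure D → (Fin 2 → ℂ) × ℂ)) := by
    refine Metric.equicontinuous_of_continuity_modulus (fun t => L * t) ?_ _ ?_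
    · have : Filter.Tendsto (fun t : ℝ => L * t) (nhds 0) (nhds (L * 0)) :=
        (continuous_const.mul continuous_id).tendsto 0
      simpa using this
    · rintro z w ⟨f, x, rfl, hf3⟩
      show dist (ι x z) (ι x w) ≤ L * dist z w
      rw [hι, restrictL_apply, restrictL_apply, dist_eq_norm, Subtype.dist_eq, dist_eq_norm]
      exact d.dist_restrict_le h12 hr₂.le (hbound x hf3) (hKr z.2) (hKr w.2)
  -- Arzelà–Ascoli: `A` is totally bounded
  have hA_in : ∀ (f : BoundedContinuousFunction (closure D) ((Fin 2 → ℂ) × ℂ)) (z : closure D), f ∈ A →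
      f z ∈ Metric.closedBall (0 : (Fin 2 → ℂ) × ℂ) 3 := by
    rintro f z ⟨x, rfl, hf3⟩
    rw [Metric.mem_closedBall, dist_zero_right]
    exact (BoundedContinuousFunction.norm_coe_le_norm _ z).trans hf3
  have hcomp : IsCompact (closure A) :=
    BoundedContinuousFunction.arzela_ascoli _ (isCompact_closedBall (0 : (Fin 2 → ℂ) × ℂ) 3) A hA_in hequi
  have htb : TotallyBounded A := hcomp.totallyBounded.subset subset_closure
  -- hence the closed ball of radius `3` of `range ι` is totally bounded
  have htbV : TotallyBounded {v : LinearMap.range ι | ‖v‖ ≤ 3} := by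
    refine (totallyBounded_preimage isUniformEmbedding_subtype_val.isUniformInducing htb).subset ?_
    intro v hv
    obtain ⟨x, hx⟩ := LinearMap.mem_range.1 v.2
    exact ⟨x, hx, by rw [Submodule.norm_coe]; exact hv⟩
  -- Riesz
  haveI hfinV : FiniteDimensional ℂ (LinearMap.range ι) :=
    finiteDimensional_of_totallyBounded (V := LinearMap.range ι) htbV
  exact LinearEquiv.finiteDimensional (V := ↥(LinearMap.range ι)) (V₂ := d.HForm Γ' D)
    (LinearEquiv.ofInjective ι hinj).symm

end TargetData

end Summit.Ventures.HodgeRepro.Tier4
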